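import Summits.QuantumFields.YangMills.Theorems.UnitScaleTiltProp7LatticeTiledCube
import Summits.QuantumFields.YangMills.Theorems.UnitScaleTiltProp7TiledCubeMemberRows
import Summits.QuantumFields.YangMills.Theorems.UnitScaleTiltProp7TentProfileZd
import Summits.QuantumFields.YangMills.Theorems.UnitScaleTiltProp7QprimeCombL2Defs
import HarnessLib

/-!
# Route `UnitScaleTilt`, crux K1 «MinimiserStabilityRegPr» (stmt-QuantumFields-19200) — route-R E′ (A′), LANE II «DIVERGENCE RECOVERY AT CURVED `W`» (★★OWNER RULING №23),
# (B7) [I-5] (a′) «THE MEMBER READING OF (B9d)», FILE 2∕3 — **THE KNIT, STAGE A: the tiled-cube covariant Poincaré inequality (B9d) (px4 ✓`Prop7LatticeTiledCube.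
# sum_tiled_sq_le_plaq`) on the box `box z R_f` of a chart `transl c`, with the fine covariant term and the `8dβ²`-term converted into the member's letters
# `‖D_W φ‖²`, `‖φ‖²` by the transport rows of FILE 1 (✓`Prop7TiledCubeMemberRows`), the box mean killed by the (B8) normalisation (0), and the coarse term
# (squared differences of the AXIAL block means of the chart function `φ_Z`) left displayed for STAGE B (FILE 3, `…TiledCubeMemberH7H8`):**
# `c₀Σ_{w ∈ box z R_f} hs(φ♭(c + w)) ≤ 8·‖D_Wφ‖² + 32ℓ²(2dR_fα)²d·‖φ‖² + 2c₀η²·(2ℓ^d·(2·(2c_m·DIFF)))` — the `8` is `R`- and `K`-free (`c·η² ≤ ℓ²η²∕2 = 1∕2`).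
# Plus the small dictionary rows STAGE B needs and that do not depend on px5's conversion: the comb box `blockIter` IS the tiled-cube block, `e = unitVec`, the comb
# weight is `(ℓ^d)⁻¹`, the tiling of the box from the two defining equations of `(z, R_f)`, `m + 1 ≤ N_{K−n}`, and the stage-B arithmetic.

Cell `ym3-torus` ∕ width seat `ym3-torus-px9` (gen 7, «width 9»).  THEOREMS ONLY (0 `def`, 0 `sorry`); `--supports stmt-QuantumFields-19200 --as helper`, count-neutral.
YM₃ on T³ is a ladder rung (R3), not d = 4, not the Clay problem; nothing here claims (B7), (REC), `hN06`, E′, EX or the gap.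

WHAT IS PROVED (ns `…Theorems.Prop7TiledCubeMemberKnit`): `knit_arith` · ★★★ `knitA` (stage A, any chart centre `c`, any block-tiled box `lo, m, hbox`, hypotheses = ⧗(B8-member)
`boxLocalPotential_member`'s conjuncts (S1b)∕(D) verbatim + (0) + lit `PlaqSmall V (z−R_f) (z+R_f) α` + `V w μ = unitsField (toUField W) ⟨transl c w, μ⟩`) · `blockIter_eq_blk` ·
`e_eq_unitVec` · `weight_eq` · `tiled_eq_box_of` · `succ_le_sitesPerDir_of` · `knitB_arith`.
HONEST SCOPE.  Bookkeeping over landed∕pending rows; nothing of (B7)∕(REC)∕`hN06`∕the crux is asserted; rung R3, not Clay; YM gap NOT proved.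

References: T. Bałaban, CMP 98 (1985) 17–51 [Balaban1985Averaging] (pp.24–25: the blockwise bounds on cubes `□`); T. Bałaban, CMP 99 (1985) 389–434
[Balaban1985BackgroundPropagators] ((3.19) p.393 the comb average; (3.100) p.413 local charts); [folklore] (arithmetic).
-/

set_option autoImplicit false

open scoped BigOperators Matrix.Norms.L2Operator

namespace Summit.QuantumFields.YangMills.Theorems.Prop7TiledCubeMemberKnit

open Literature.MathematicalPhysics.QuantumFieldTheory.Balaban1983to89
open Literature.MathematicalPhysics.QuantumFieldTheory.Balaban1983to89.T3ContinuumYM3Torus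
open Literature.MathematicalPhysics.QuantumFieldTheory.Balaban1983to89.B4Eq19LatticeOperators (Zd box unitVec mem_box)
open Literature.MathematicalPhysics.QuantumLattice (blockMap blockBase blockSites mem_blockSites_iff)
open B10Eq27TorusAxialLog (transl unitsField toUField)
open B7Prop1Explicit (axialFn e)
open B7Eq78Linearization (conjR conjR_apply)
open B9B8AveragingKernelZd (blockIter)
open T3SectALandauChart (eta eta_pos)
open B11Eq103H1Complex (SiteL2K BondL2K)
open Summit.QuantumFields.YangMills.Theorems.Prop7SectET3Transport (periodsT3)
open Summit.QuantumFields.YangMills.Theorems.Prop7SectET3HilbertLetters (W₂ toL2 toL2S DL2)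
open Summit.QuantumFields.YangMills.Theorems.Prop7QprimeCombL2 (sitesPerDir_zero_eq)
open Summit.QuantumFields.YangMills.Theorems.Prop7LatticeTiledCube (sum_tiled_sq_le_plaq mem_blk_iff_ediv)
open Summit.QuantumFields.YangMills.Theorems.Prop7TiledCubeMemberRows (chart_mass_le eta_sq_sum_opNorm_sq_le_norm_sq cov_sum_le_norm_DL2_sq)
open Summit.QuantumFields.YangMills.Theorems.Prop7TentProfileZd (blockIter_eq_blockSites_pow)

variable (F : T3Family) (n K : ℕ) (c₀ : ℝ) [Fact (0 < c₀)]

/-! ## §1 Stage A: (B9d) on the chart box, fine terms in member currency -/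

/-- Pure arithmetic of the knit: the three pieces of (B9d)'s right side in member currency. -/
theorem knit_arith {c₀ η ℓr cc COV S DIFF d β ℓd cm Nr G Φ LHS : ℝ}
    (hc : 0 ≤ c₀) (hCOV0 : 0 ≤ COV) (hS0 : 0 ≤ S) (hd : 0 ≤ d) (hN : Nr = 2)
    (hA : LHS ≤ 2 * (c₀ * η ^ 2) * S)
    (h9 : S ≤ 2 * (Nr * cc * (2 * COV + 8 * d * β ^ 2 * S)) + 2 * ℓd * (2 * (Nr * cm * DIFF)))
    (hB : c₀ * COV ≤ G) (hC : c₀ * η ^ 2 * S ≤ Φ)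
    (hcc1 : cc * η ^ 2 ≤ 1 / 2) (hcc2 : cc ≤ ℓr ^ 2 / 2) :
    LHS ≤ 8 * G + 32 * ℓr ^ 2 * β ^ 2 * d * Φ + 2 * (c₀ * η ^ 2) * (2 * ℓd * (2 * (2 * cm * DIFF))) := by
  subst hN
  have p1 : cc * η ^ 2 * (c₀ * COV) ≤ 1 / 2 * G :=
    mul_le_mul hcc1 hB (mul_nonneg hc hCOV0) (by norm_num)
  have p2 : cc * (c₀ * η ^ 2 * S) ≤ ℓr ^ 2 / 2 * Φ :=
    mul_le_mul hcc2 hC (by positivity) (by positivity)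
  have p3 : 2 * (c₀ * η ^ 2) * S
      ≤ 2 * (c₀ * η ^ 2) * (2 * (2 * cc * (2 * COV + 8 * d * β ^ 2 * S)) + 2 * ℓd * (2 * (2 * cm * DIFF))) :=
    mul_le_mul_of_nonneg_left h9 (by positivity)
  have p4 : d * β ^ 2 * (cc * (c₀ * η ^ 2 * S)) ≤ d * β ^ 2 * (ℓr ^ 2 / 2 * Φ) :=
    mul_le_mul_of_nonneg_left p2 (by positivity)
  have e : 2 * (c₀ * η ^ 2) * (2 * (2 * cc * (2 * COV + 8 * d * β ^ 2 * S)) + 2 * ℓd * (2 * (2 * cm * DIFF)))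
      = 16 * (cc * η ^ 2 * (c₀ * COV)) + 64 * (d * β ^ 2 * (cc * (c₀ * η ^ 2 * S)))
        + 2 * (c₀ * η ^ 2) * (2 * ℓd * (2 * (2 * cm * DIFF))) := by ring
  have e' : 32 * ℓr ^ 2 * β ^ 2 * d * Φ = 64 * (d * β ^ 2 * (ℓr ^ 2 / 2 * Φ)) := by ring
  linarith [p1, p3, p4, e, e']

/-- ★★★ **STAGE A — (B9d) ON THE CHART BOX WITH THE FINE TERMS IN MEMBER CURRENCY**: for any chart centre `c`, a box `box z R_f` (`2R_f + 1 ≤ N₀`) that is exactly the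
tiled cube of the blocks `b ∈ lo + [0,m]^d` (`hbox`), the box pull-back `V` of `W` with `PlaqSmall V (z−R_f) (z+R_f) α`, a member field `φ` with chart function `φ_Z`
(rows `hφZ`, `hD` of (B8-member)) normalised by (0) (`h0`):
`c₀Σ_{w ∈ box}hs(φ♭(c + w)) ≤ 8‖D_Wφ‖² + 32ℓ²(2dR_fα)²d‖φ‖² + 2c₀η²·(2ℓ^d·(2·(2·(m(m+1)∕2)·DIFF)))`, `DIFF` = (B9d)'s coarse double sum over the axial block means of `φ_Z`.
[cite: Balaban1985Averaging, pp.24-25; Balaban1985BackgroundPropagators, (3.100) p.413] -/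
theorem knitA (W : GaugeField (F.P K) 0 (Matrix.specialUnitaryGroup (Fin 2) ℂ))
    (c : Site (F.P K) 0) {z : Zd (F.P K).d} {Rf : ℤ} (hRN : 2 * Rf + 1 ≤ ((F.P K).sitesPerDir 0 : ℤ))
    (lo : Zd (F.P K).d) (m : ℕ)
    (hbox : Fintype.piFinset (fun i => Finset.Icc (((F.L ^ (K - n) : ℕ) : ℤ) * lo i) (((F.L ^ (K - n) : ℕ) : ℤ) * lo i + (((m + 1) * F.L ^ (K - n) - 1 : ℕ) : ℤ)))
      = box z Rf)
    (V : Zd (F.P K).d → Fin (F.P K).d → (Matrix (Fin 2) (Fin 2) ℂ)ˣ) (hV : ∀ w μ, V w μ = unitsField (toUField W) ⟨transl c w, μ⟩)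
    {α : ℝ} (hα : 0 ≤ α) (hP : B8Lemma1NonAbelian.PlaqSmall V (fun i => z i - Rf) (fun i => z i + Rf) α)
    (φ : SiteL2K ℂ 3 (periodsT3 F K) c₀ W₂) (φZ : Zd (F.P K).d → Matrix (Fin 2) (Fin 2) ℂ)
    (hφZ : ∀ w ∈ box z Rf, (toL2S F K c₀).symm φ (transl c w) = (eta F n K) • φZ w)
    (hD : ∀ w ∈ box z Rf, ∀ μ, w + unitVec μ ∈ box z Rf →
      (toL2 F K c₀).symm (DL2 F n K c₀ W φ) ⟨transl c w, μ⟩ = conjR (V w μ) (φZ (w + unitVec μ)) - φZ w)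
    (h0 : ∑ w ∈ box z Rf, conjR (axialFn V (fun i => z i - Rf) w) (φZ w) = 0) :
    c₀ * ∑ w ∈ box z Rf, ∑ j : Fin 2, ∑ k : Fin 2, ‖((toL2S F K c₀).symm φ (transl c w)) j k‖ ^ 2
      ≤ 8 * ‖DL2 F n K c₀ W φ‖ ^ 2
        + 32 * ((F.L : ℝ) ^ (K - n)) ^ 2 * (2 * ((F.P K).d : ℝ) * Rf * α) ^ 2 * ((F.P K).d : ℝ) * ‖φ‖ ^ 2
        + 2 * (c₀ * (eta F n K) ^ 2) * (2 * (((F.L ^ (K - n)) ^ (F.P K).d : ℕ) : ℝ) *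
          (2 * (2 * ((m : ℝ) * (m + 1) / 2) *
              ∑ b ∈ Fintype.piFinset (fun i => Finset.Icc (lo i) (lo i + m)), ∑ μ,
                (if b + unitVec μ ∈ Fintype.piFinset (fun i => Finset.Icc (lo i) (lo i + m)) then
                  ‖((((F.L ^ (K - n)) ^ (F.P K).d : ℕ) : ℝ) : ℂ)⁻¹ • ∑ x' ∈ Fintype.piFinset (fun i => Finset.Icc (((F.L ^ (K - n) : ℕ) : ℤ) * (b + unitVec μ) i) (((F.L ^ (K - n) : ℕ) : ℤ) * (b + unitVec μ) i + ((F.L ^ (K - n) - 1 : ℕ) : ℤ))),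
                      conjR (axialFn V (fun i => z i - Rf) x') (φZ x')
                    - ((((F.L ^ (K - n)) ^ (F.P K).d : ℕ) : ℝ) : ℂ)⁻¹ • ∑ x' ∈ Fintype.piFinset (fun i => Finset.Icc (((F.L ^ (K - n) : ℕ) : ℤ) * b i) (((F.L ^ (K - n) : ℕ) : ℤ) * b i + ((F.L ^ (K - n) - 1 : ℕ) : ℤ))),
                      conjR (axialFn V (fun i => z i - Rf) x') (φZ x')‖ ^ 2
                else 0)))) := by
  classical
  have hc : 0 < c₀ := Fact.out
  have hL : 0 < F.L := by have := F.hL.2; omega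
  have hLR : (0 : ℝ) < F.L := by exact_mod_cast hL
  have hℓ : 1 ≤ F.L ^ (K - n) := Nat.one_le_pow _ _ hL
  -- the pull-back connection is unitary
  have hVu : ∀ w μ, V w μ ∈ B7Prop2Explicit.unitaryUnits (Matrix (Fin 2) (Fin 2) ℂ) := fun w μ => by
    rw [hV]; exact B10Eq27TorusAxialLog.unitsField_mem_unitaryUnits (toUField W) _
  have hsub : Fintype.piFinset (fun i => Finset.Icc (((F.L ^ (K - n) : ℕ) : ℤ) * lo i)
      (((F.L ^ (K - n) : ℕ) : ℤ) * lo i + (((m + 1) * F.L ^ (K - n) - 1 : ℕ) : ℤ))) ⊆ box z Rf := hbox.le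
  -- (B9d) on the tiled cube = the box
  have h9 := sum_tiled_sq_le_plaq (N := 2) hℓ lo m hα V hVu hP hsub φZ
  rw [hbox] at h9
  -- the overall mean vanishes by the normalisation (B8)(0)
  have hm : ‖((((box z Rf).card : ℝ)) : ℂ)⁻¹ • ∑ x ∈ box z Rf, conjR (axialFn V (fun i => z i - Rf) x) (φZ x)‖ ^ 2 = 0 := by
    rw [h0, smul_zero, norm_zero, zero_pow two_ne_zero]
  rw [hm, mul_zero, add_zero] at h9
  -- the member rows
  have hA := chart_mass_le F n K c₀ c φ φZ hφZ (box z Rf) (Finset.Subset.refl _)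
  have hB := cov_sum_le_norm_DL2_sq F n K c₀ W c hRN V φ φZ hD (box z Rf) (Finset.Subset.refl _)
  have hC := eta_sq_sum_opNorm_sq_le_norm_sq F n K c₀ c hRN φ φZ hφZ (box z Rf) (Finset.Subset.refl _)
  -- scale facts: `η ℓ = 1`, `c = ℓ(ℓ−1)/2 ≤ ℓ²/2`
  have hηℓ : eta F n K * (F.L : ℝ) ^ (K - n) = 1 := by
    show ((F.L : ℝ)⁻¹) ^ (K - n) * (F.L : ℝ) ^ (K - n) = 1
    rw [← mul_pow, inv_mul_cancel₀ hLR.ne', one_pow]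
  have hsq : ((F.L : ℝ) ^ (K - n)) ^ 2 * (eta F n K) ^ 2 = 1 := by rw [← mul_pow, mul_comm, hηℓ, one_pow]
  have e1 : (((F.L ^ (K - n) - 1 : ℕ) : ℝ) + 1) = (F.L : ℝ) ^ (K - n) := by
    rw [Nat.cast_sub hℓ]; push_cast; ring
  have hcc2 : ((F.L ^ (K - n) - 1 : ℕ) : ℝ) * (((F.L ^ (K - n) - 1 : ℕ) : ℝ) + 1) / 2 ≤ ((F.L : ℝ) ^ (K - n)) ^ 2 / 2 := by
    rw [e1]
    have e2 : ((F.L ^ (K - n) - 1 : ℕ) : ℝ) ≤ (F.L : ℝ) ^ (K - n) := by linarith [e1]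
    have h0' : (0 : ℝ) ≤ (F.L : ℝ) ^ (K - n) := by positivity
    nlinarith [e2, h0']
  have hcc1 : ((F.L ^ (K - n) - 1 : ℕ) : ℝ) * (((F.L ^ (K - n) - 1 : ℕ) : ℝ) + 1) / 2 * (eta F n K) ^ 2 ≤ 1 / 2 := by
    have := mul_le_mul_of_nonneg_right hcc2 (sq_nonneg (eta F n K))
    have e3 : ((F.L : ℝ) ^ (K - n)) ^ 2 / 2 * (eta F n K) ^ 2 = 1 / 2 := by
      rw [div_mul_eq_mul_div, hsq]
    linarith [e3]
  have hCOV0 : 0 ≤ ∑ x ∈ box z Rf, ∑ μ, (if x + unitVec μ ∈ box z Rf then ‖conjR (V x μ) (φZ (x + unitVec μ)) - φZ x‖ ^ 2 else 0) :=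
    Finset.sum_nonneg fun x _ => Finset.sum_nonneg fun μ _ => by split_ifs <;> positivity
  have hS0 : 0 ≤ ∑ x ∈ box z Rf, ‖φZ x‖ ^ 2 := Finset.sum_nonneg fun x _ => by positivity
  have hd0 : (0 : ℝ) ≤ ((F.P K).d : ℝ) := Nat.cast_nonneg _
  have hN : ((2 : ℕ) : ℝ) = 2 := by norm_num
  exact knit_arith hc.le hCOV0 hS0 hd0 hN hA h9 hB hC hcc1 hcc2

/-! ## §2 Dictionary rows for stage B (no conversion content) -/

/-- The comb box of level `K − n` IS the `ℓ`-block of the tiled-cube letters (`ℓ = L^{K−n}`). -/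
theorem blockIter_eq_blk (b : Zd (F.P K).d) :
    blockIter (F.P K).L (K - n) b
      = Fintype.piFinset (fun i => Finset.Icc (((F.L ^ (K - n) : ℕ) : ℤ) * b i) (((F.L ^ (K - n) : ℕ) : ℤ) * b i + ((F.L ^ (K - n) - 1 : ℕ) : ℤ))) := by
  have hL : 0 < F.L := by have := F.hL.2; omega
  have hℓ : 1 ≤ F.L ^ (K - n) := Nat.one_le_pow _ _ hL
  haveI : NeZero (F.P K).L := ⟨show F.L ≠ 0 by omega⟩
  haveI : NeZero ((F.P K).L ^ (K - n)) := ⟨show F.L ^ (K - n) ≠ 0 by positivity⟩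
  ext x
  rw [blockIter_eq_blockSites_pow, mem_blockSites_iff, mem_blk_iff_ediv hℓ]
  show (fun i => x i / (((F.L ^ (K - n) : ℕ)) : ℤ)) = b ↔ _
  exact funext_iff

/-- The two unit-vector letters agree. -/
theorem e_eq_unitVec (μ : Fin (F.P K).d) : e μ = unitVec μ := rfl

/-- The comb weight `((L^d)⁻¹)^{K−n}` is `(ℓ^d)⁻¹`. -/
theorem weight_eq : ((((F.P K).L : ℝ) ^ (F.P K).d)⁻¹) ^ (K - n) = ((((F.L ^ (K - n)) ^ (F.P K).d : ℕ) : ℝ))⁻¹ := by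
  rw [show (F.P K).L = F.L from rfl, ← inv_pow]; push_cast; rw [← pow_mul, ← pow_mul, mul_comm, inv_pow]

/-- The box of the knit is the tiled cube (from the two defining equations of `z`, `R_f`). -/
theorem tiled_eq_box_of {z : Zd (F.P K).d} {Rf : ℤ} (lo : Zd (F.P K).d) (m : ℕ)
    (hzlo : ∀ i, z i - Rf = ((F.L ^ (K - n) : ℕ) : ℤ) * lo i)
    (hzhi : ∀ i, z i + Rf = ((F.L ^ (K - n) : ℕ) : ℤ) * lo i + (((m + 1) * F.L ^ (K - n) - 1 : ℕ) : ℤ)) :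
    Fintype.piFinset (fun i => Finset.Icc (((F.L ^ (K - n) : ℕ) : ℤ) * lo i)
        (((F.L ^ (K - n) : ℕ) : ℤ) * lo i + (((m + 1) * F.L ^ (K - n) - 1 : ℕ) : ℤ))) = box z Rf := by
  ext w
  simp only [Fintype.mem_piFinset, Finset.mem_Icc, mem_box]
  refine forall_congr' fun i => ?_
  rw [abs_le, ← hzhi i, ← hzlo i]
  constructor
  · rintro ⟨h1, h2⟩; constructor <;> linarith
  · rintro ⟨h1, h2⟩; constructor <;> linarith

/-- `2R_f + 1 = (m+1)·ℓ ≤ N₀ = ℓ·N_{K−n}` forces `m + 1 ≤ N_{K−n}`. -/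
theorem succ_le_sitesPerDir_of (hnK : n ≤ K) {z : Zd (F.P K).d} {Rf : ℤ} (hRN : 2 * Rf + 1 ≤ ((F.P K).sitesPerDir 0 : ℤ))
    (lo : Zd (F.P K).d) (m : ℕ) (i : Fin (F.P K).d)
    (hzlo : z i - Rf = ((F.L ^ (K - n) : ℕ) : ℤ) * lo i)
    (hzhi : z i + Rf = ((F.L ^ (K - n) : ℕ) : ℤ) * lo i + (((m + 1) * F.L ^ (K - n) - 1 : ℕ) : ℤ)) :
    (m : ℤ) + 1 ≤ ((F.P K).sitesPerDir (K - n) : ℤ) := by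
  have hL : 0 < F.L := by have := F.hL.2; omega
  have hℓ : 1 ≤ F.L ^ (K - n) := Nat.one_le_pow _ _ hL
  have hN0 : ((F.P K).sitesPerDir 0 : ℤ) = ((F.L ^ (K - n) : ℕ) : ℤ) * ((F.P K).sitesPerDir (K - n) : ℤ) := by
    rw [sitesPerDir_zero_eq F n K hnK]; push_cast; rfl
  have hcast : (((m + 1) * F.L ^ (K - n) - 1 : ℕ) : ℤ) = ((m : ℤ) + 1) * ((F.L ^ (K - n) : ℕ) : ℤ) - 1 := by
    have h1 : 1 ≤ (m + 1) * F.L ^ (K - n) := Nat.one_le_iff_ne_zero.mpr (by positivity)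
    rw [Nat.cast_sub h1]; push_cast; ring
  have h2 : 2 * Rf + 1 = ((m : ℤ) + 1) * ((F.L ^ (K - n) : ℕ) : ℤ) := by linarith [hzlo, hzhi, hcast]
  rw [h2, hN0] at hRN
  have hℓ' : (0 : ℤ) < ((F.L ^ (K - n) : ℕ) : ℤ) := by exact_mod_cast hℓ
  exact le_of_mul_le_mul_right (by linarith [mul_comm ((m : ℤ) + 1) (((F.L ^ (K - n) : ℕ) : ℤ))]) hℓ'

/-- Pure arithmetic of stage B. -/
theorem knitB_arith {LHS G AΦ Φ c₀ η ℓd cm DIFF SY SX ω γ' γ S1 S2 SZ d : ℝ}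
    (hc : 0 ≤ c₀) (hcm : 0 ≤ cm) (hℓd : 0 < ℓd) (hd : 0 ≤ d)
    (hA : LHS ≤ 8 * G + AΦ + 2 * (c₀ * η ^ 2) * (2 * ℓd * (2 * (2 * cm * DIFF))))
    (hY : SY = η ^ 2 * DIFF) (hω : ω = ℓd⁻¹)
    (hconv : SY ≤ 2 * SX + 4 * ω * (γ' ^ 2 * S1 + γ ^ 2 * S2))
    (hS1 : S1 ≤ d * (η ^ 2 * SZ)) (hS2 : S2 ≤ d * (η ^ 2 * SZ)) (hC : c₀ * η ^ 2 * SZ ≤ Φ) :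
    LHS ≤ 8 * G + AΦ + 32 * cm * (c₀ * ℓd * SX) + 64 * cm * d * (γ' ^ 2 + γ ^ 2) * Φ := by
  subst hω
  have e1 : 2 * (c₀ * η ^ 2) * (2 * ℓd * (2 * (2 * cm * DIFF))) = 16 * cm * c₀ * ℓd * SY := by rw [hY]; ring
  have h2 : 16 * cm * c₀ * ℓd * SY ≤ 16 * cm * c₀ * ℓd * (2 * SX + 4 * ℓd⁻¹ * (γ' ^ 2 * S1 + γ ^ 2 * S2)) :=
    mul_le_mul_of_nonneg_left hconv (by positivity)
  have e3 : 16 * cm * c₀ * ℓd * (2 * SX + 4 * ℓd⁻¹ * (γ' ^ 2 * S1 + γ ^ 2 * S2))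
      = 32 * cm * (c₀ * ℓd * SX) + 64 * cm * c₀ * (γ' ^ 2 * S1 + γ ^ 2 * S2) := by
    field_simp; ring
  have h4 : γ' ^ 2 * S1 + γ ^ 2 * S2 ≤ (γ' ^ 2 + γ ^ 2) * (d * (η ^ 2 * SZ)) := by
    nlinarith [mul_le_mul_of_nonneg_left hS1 (sq_nonneg γ'), mul_le_mul_of_nonneg_left hS2 (sq_nonneg γ)]
  have h5 : 64 * cm * c₀ * (γ' ^ 2 * S1 + γ ^ 2 * S2) ≤ 64 * cm * c₀ * ((γ' ^ 2 + γ ^ 2) * (d * (η ^ 2 * SZ))) :=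
    mul_le_mul_of_nonneg_left h4 (by positivity)
  have e6 : 64 * cm * c₀ * ((γ' ^ 2 + γ ^ 2) * (d * (η ^ 2 * SZ))) = 64 * cm * d * (γ' ^ 2 + γ ^ 2) * (c₀ * η ^ 2 * SZ) := by ring
  have h7 : 64 * cm * d * (γ' ^ 2 + γ ^ 2) * (c₀ * η ^ 2 * SZ) ≤ 64 * cm * d * (γ' ^ 2 + γ ^ 2) * Φ :=
    mul_le_mul_of_nonneg_left hC (by positivity)
  linarith [e1, h2, e3, h5, e6, h7]

end Summit.QuantumFields.YangMills.Theorems.Prop7TiledCubeMemberKnit
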